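import Literature.IUT.LogVolume.TensorPacketHull
import HarnessLib

/-!
# Containers for the hull of a union of possible images on a tensor packet ([IUTchIV] Thm. 1.10, proof,
# Steps (v)–(vi), read on `V = ⊗_{ℚ_p} k_i`)

Mochizuki, *Inter-universal Teichmüller theory IV* (RIMS ms Apr. 2020 = PRIMS **57** (2021)), proof of
Theorem 1.10, Step (v), p. 27–28: "the inclusion “`φ(p^λ·(R_I)^∼) ⊆ p^{⌊λ−d_I−a_I⌋}·log_p(R_I^×)`” of
Proposition 1.4, (iii), implies that [a fixed multiple of `log_p(R_I^×)`] contains the “union of possible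
images of a Θ-pilot object” … That is to say, the indeterminacies (Ind1) and (Ind2) are taken into account
by the arbitrary nature of the automorphism “`φ`” [cf. Proposition 1.2] … Thus, an upper bound on the
component of the log-volume of the holomorphic hull … may be obtained by computing an upper bound for the
log-volume of the right-hand side of the inclusion “`p^{⌊λ−d_I−a_I⌋}·log_p(R_I^×) ⊆
p^{⌊λ−d_I−a_I⌋−b_I}·(R_I)^∼`”"; Step (vi), p. 29: "the inclusion “`φ((R_I)^∼) ⊆ (R_I)^∼`” of Proposition 1.4,
(iv), implies that the tensor product of log-shells under consideration contains the “union of possible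
images of a Θ-pilot object” … the “container of possible images” is precisely equal to [`(R_I)^∼`]".

THIS FILE isolates the SET-THEORETIC content of those two sentences on the cell's tensor packet
`V = PacketAlgebra p k` (abc-iut-S1, `TensorPacketRing.lean`), over the intrinsic hull `packetHull`
(`TensorPacketHull.lean`) and the TYPED statements `Prop12ii` / `Prop12iv` of [IUTchIV] Prop. 1.2 (whose
proofs are campaign files of abc-iut-S6; here they are HYPOTHESES `h12 : Prop12ii p k` / `h4 : Prop12iv p k`):
* `autImages p k A` — the union, over ALL `ℚ_p`-linear automorphisms `φ` of `V` inducing an automorphism of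
  `log_p(R_I^×)` (`IsLogPacketAut`), of the images `φ(A)` of a region `A ⊆ V` ("the arbitrary nature of the
  automorphism `φ`"); `subset_autImages` (`φ = id`), `image_subset_autImages`;
* `autImages_smul_normalizedPacket_subset_ppow_smul_logPacket` / `…_subset_translate` — under `Prop12ii`, for
  `g ∈ k_{i†}` of order `λ = m/e_{i†}` and `n := ⌊λ − d_I − a_I⌋`: the union of possible images of
  `g·(R_I)^∼` ("`p^λ·(R_I)^∼`") lies in `p^n·log_p(R_I^×)` and in the translate `(p^n·⊗h_i)·(R_I)^∼`
  (`h` realising `p^{−b_I}`), and — the point of the hull file — `packetHull_autImages_smul_subset_translate`: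
  SO DOES ITS HOLOMORPHIC HULL (translates are hull-closed);
* `autImages_normalizedPacket_eq` / `packetHull_autImages_normalizedPacket` — under `Prop12iv`
  (`p > 2`, all `e_i = 1`): the union of possible images of `(R_I)^∼` and its hull are `(R_I)^∼` itself
  (Step (vi): "the “container of possible images” is precisely equal to" the tensor product of log-shells'
  integral structure).
The log-volumes of the translates `(p^n·⊗h_i)·(R_I)^∼` are abc-iut-S8's (`TensorPacketVolume`,
`LogVolumeEstimates`: `≤ (−λ + d_I + 1)·log p + Σ_{I*}(3 + log e_i)`); the (Ind3) enlargement and the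
permutation of tensor slots ((Ind1) in Dupuy–Hilado's indexing) are NOT modelled by `autImages` and belong to
the packet-model files (`MultiradialRegion.lean` and its instance). Nothing here takes a side on
[IUTchIII] Cor. 3.12; the text's claim that the Θ-pilot's possible images ARE of the form `φ(p^λ·(R_I)^∼)` is
exactly what the disputed step supplies and is NOT asserted here. [cite: Mochizuki2012, IUTchIV Thm 1.10
proof Step (v) p.27–28, Step (vi) p.29]
-/

noncomputable section

open Set
open scoped Pointwise TensorProduct

namespace Literature.IUT.LogVolume

variable (p : ℕ) [Fact p.Prime]
variable {I : Type} [Fintype I] [DecidableEq I]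
variable (k : I → Type) [∀ i, NontriviallyNormedField (k i)] [∀ i, NormedAlgebra ℚ_[p] (k i)]

/-! ## The union of possible images under the log-shell automorphisms -/

/-- **The union of possible images** of a region `A ⊆ V` under "the arbitrary … automorphism `φ`" of
[IUTchIV] Prop. 1.2 / Thm. 1.10 Step (v): `⋃ φ(A)` over all `ℚ_p`-linear automorphisms `φ` of `V` that
induce an automorphism of the submodule `log_p(R_I^×)` (`IsLogPacketAut`).
[cite: Mochizuki2012, IUTchIV Thm 1.10 proof Step (v) p.27] -/
def autImages (A : Set (PacketAlgebra p k)) : Set (PacketAlgebra p k) :=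
  ⋃ φ : {φ : PacketAlgebra p k ≃ₗ[ℚ_[p]] PacketAlgebra p k // IsLogPacketAut p k φ}, (φ.1 : _ → _) '' A

omit [Fintype I] [DecidableEq I] in
/-- Membership in the union of possible images. [cite: Mochizuki2012, IUTchIV Thm 1.10 proof Step (v) p.27] -/
theorem mem_autImages_iff {A : Set (PacketAlgebra p k)} {x : PacketAlgebra p k} :
    x ∈ autImages p k A ↔
      ∃ φ : PacketAlgebra p k ≃ₗ[ℚ_[p]] PacketAlgebra p k, IsLogPacketAut p k φ ∧ x ∈ (φ : _ → _) '' A := by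
  constructor
  · intro hx
    obtain ⟨φ, hφ⟩ := Set.mem_iUnion.mp hx
    exact ⟨φ.1, φ.2, hφ⟩
  · rintro ⟨φ, hφ, hx⟩
    exact Set.mem_iUnion.mpr ⟨⟨φ, hφ⟩, hx⟩

omit [Fintype I] [DecidableEq I] in
/-- The identity induces an automorphism of `log_p(R_I^×)`. [cite: Mochizuki2012, IUTchIV Prop 1.2 p.10] -/
theorem isLogPacketAut_refl : IsLogPacketAut p k (LinearEquiv.refl ℚ_[p] (PacketAlgebra p k)) := by
  unfold IsLogPacketAut
  exact Set.image_id _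

omit [Fintype I] [DecidableEq I] in
/-- Every image `φ(A)` is among the possible images. [cite: Mochizuki2012, IUTchIV Thm 1.10 proof Step (v) p.27] -/
theorem image_subset_autImages {A : Set (PacketAlgebra p k)} {φ : PacketAlgebra p k ≃ₗ[ℚ_[p]] PacketAlgebra p k}
    (hφ : IsLogPacketAut p k φ) : (φ : _ → _) '' A ⊆ autImages p k A :=
  fun _ hx => (mem_autImages_iff p k).mpr ⟨φ, hφ, hx⟩

omit [Fintype I] [DecidableEq I] in
/-- The region itself is among its possible images (`φ = id`). [cite: Mochizuki2012, IUTchIV Thm 1.10 proof Step (v) p.27] -/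
theorem subset_autImages (A : Set (PacketAlgebra p k)) : A ⊆ autImages p k A := by
  intro x hx
  refine (mem_autImages_iff p k).mpr ⟨LinearEquiv.refl ℚ_[p] _, isLogPacketAut_refl p k, ?_⟩
  exact ⟨x, hx, rfl⟩

omit [Fintype I] [DecidableEq I] in
/-- If every admissible `φ` maps `A` into `C`, the union of possible images lies in `C`.
[cite: Mochizuki2012, IUTchIV Thm 1.10 proof Step (v) p.27] -/
theorem autImages_subset {A C : Set (PacketAlgebra p k)}
    (h : ∀ φ : PacketAlgebra p k ≃ₗ[ℚ_[p]] PacketAlgebra p k, IsLogPacketAut p k φ → (φ : _ → _) '' A ⊆ C) :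
    autImages p k A ⊆ C := by
  intro x hx
  obtain ⟨φ, hφ, hx⟩ := (mem_autImages_iff p k).mp hx
  exact h φ hφ hx

/-! ## Step (v): the container of the possible images of `p^λ·(R_I)^∼` and of their hull -/

section StepV

variable [∀ i, IsUltrametricDist (k i)] [∀ i, ProperSpace (k i)]

/-- **Step (v), first inclusion**: under [IUTchIV] Prop. 1.2 (ii) (`Prop12ii`, hypothesis), for `|I| ≥ 2`,
`i† ∈ I`, `g ∈ k_{i†}` with `ord(g) = λ = m/e_{i†}`, and `n := ⌊λ − d_I − a_I⌋`: the union of the possible images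
of `g·(R_I)^∼` ("`p^λ·(R_I)^∼`") lies in `p^n·log_p(R_I^×)` — "the inclusion … implies that [a multiple of
`log_p(R_I^×)`] contains the union of possible images … (Ind1) and (Ind2) are taken into account by the
arbitrary nature of the automorphism `φ`". [cite: Mochizuki2012, IUTchIV Thm 1.10 proof Step (v) p.27] -/
theorem autImages_smul_normalizedPacket_subset_ppow_smul_logPacket (h12 : Prop12ii p k)
    (hI : 2 ≤ Fintype.card I) (i : I) (m : ℤ) (g : k i)
    (hg : ‖g‖ = (p : ℝ) ^ (-((m : ℝ) / absRamificationIdx p (k i))))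
    (h : Π i, k i) (hh : RealizesNegB p k h) :
    autImages p k (iota p k i g • (normalizedPacket p k : Set (PacketAlgebra p k))) ⊆
      ppow p k ⌊(m : ℝ) / absRamificationIdx p (k i) - dSum p k - aSum p k⌋ •
        (logPacket p k : Set (PacketAlgebra p k)) :=
  autImages_subset p k fun φ hφ => (h12 hI φ hφ i m g hg h hh).1

/-- **Step (v), the container**: under `Prop12ii`, with the same data and `h` realising `p^{−b_I}`, the union
of possible images of `g·(R_I)^∼` lies in the TRANSLATE `(p^n·⊗h_i)·(R_I)^∼` ("`p^{⌊λ−d_I−a_I⌋−b_I}·(R_I)^∼`",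
the right-hand side of the second inclusion of Prop. 1.4 (iii)). [cite: Mochizuki2012, IUTchIV Thm 1.10 proof Step (v) p.28] -/
theorem autImages_smul_normalizedPacket_subset_translate (h12 : Prop12ii p k)
    (hI : 2 ≤ Fintype.card I) (i : I) (m : ℤ) (g : k i)
    (hg : ‖g‖ = (p : ℝ) ^ (-((m : ℝ) / absRamificationIdx p (k i))))
    (h : Π i, k i) (hh : RealizesNegB p k h) :
    autImages p k (iota p k i g • (normalizedPacket p k : Set (PacketAlgebra p k))) ⊆
      (ppow p k ⌊(m : ℝ) / absRamificationIdx p (k i) - dSum p k - aSum p k⌋ * purePacket p k h) •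
        (normalizedPacket p k : Set (PacketAlgebra p k)) :=
  autImages_subset p k fun φ hφ => (h12 hI φ hφ i m g hg h hh).1.trans (h12 hI φ hφ i m g hg h hh).2

/-- **Step (v), the hull of the union of possible images**: under `Prop12ii`, the HOLOMORPHIC HULL of the
union of possible images of `g·(R_I)^∼` lies in the translate `(p^n·⊗h_i)·(R_I)^∼` — "an upper bound on the
component of the log-volume of the holomorphic hull … may be obtained by computing an upper bound for the
log-volume of the right-hand side" (translates of `(R_I)^∼` are hull-closed,
`TensorPacketHull.packetHull_subset_smul_normalizedPacket`). [cite: Mochizuki2012, IUTchIV Thm 1.10 proof Step (v) p.28] -/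
theorem packetHull_autImages_smul_subset_translate (h12 : Prop12ii p k)
    (hI : 2 ≤ Fintype.card I) (i : I) (m : ℤ) (g : k i)
    (hg : ‖g‖ = (p : ℝ) ^ (-((m : ℝ) / absRamificationIdx p (k i))))
    (h : Π i, k i) (hh : RealizesNegB p k h) :
    packetHull p k (autImages p k (iota p k i g • (normalizedPacket p k : Set (PacketAlgebra p k)))) ⊆
      (ppow p k ⌊(m : ℝ) / absRamificationIdx p (k i) - dSum p k - aSum p k⌋ * purePacket p k h) •
        (normalizedPacket p k : Set (PacketAlgebra p k)) :=
  packetHull_subset_smul_normalizedPacket p k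
    (autImages_smul_normalizedPacket_subset_translate p k h12 hI i m g hg h hh)

/-- The same for the hull of ANY region all of whose points are possible images of points of `g·(R_I)^∼`
(e.g. a union of some of the `φ(g·(R_I)^∼)`, or the region itself): it lies in the translate.
[cite: Mochizuki2012, IUTchIV Thm 1.10 proof Step (v) p.28] -/
theorem packetHull_subset_translate_of_subset_autImages (h12 : Prop12ii p k)
    (hI : 2 ≤ Fintype.card I) (i : I) (m : ℤ) (g : k i)
    (hg : ‖g‖ = (p : ℝ) ^ (-((m : ℝ) / absRamificationIdx p (k i))))
    (h : Π i, k i) (hh : RealizesNegB p k h) {U : Set (PacketAlgebra p k)}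
    (hU : U ⊆ autImages p k (iota p k i g • (normalizedPacket p k : Set (PacketAlgebra p k)))) :
    packetHull p k U ⊆
      (ppow p k ⌊(m : ℝ) / absRamificationIdx p (k i) - dSum p k - aSum p k⌋ * purePacket p k h) •
        (normalizedPacket p k : Set (PacketAlgebra p k)) :=
  (packetHull_mono p k hU).trans (packetHull_autImages_smul_subset_translate p k h12 hI i m g hg h hh)

end StepV

/-! ## Step (vi): in the unramified case the container is `(R_I)^∼` itself -/

section StepVI

variable [∀ i, IsUltrametricDist (k i)] [∀ i, ProperSpace (k i)]

omit [DecidableEq I] in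
/-- **Step (vi), the container**: under [IUTchIV] Prop. 1.2 (iv) (`Prop12iv`, hypothesis: `p > 2`, all
`e_i = 1`, `|I| ≥ 2`), the union of the possible images of `(R_I)^∼` is `(R_I)^∼` — "the “container of possible
images” is precisely equal to" the integral structure of the tensor product of log-shells.
[cite: Mochizuki2012, IUTchIV Thm 1.10 proof Step (vi) p.29] -/
theorem autImages_normalizedPacket_eq (h4 : Prop12iv p k) (hI : 2 ≤ Fintype.card I) (hp : 2 < p)
    (he : ∀ i, absRamificationIdx p (k i) = 1) :
    autImages p k (normalizedPacket p k : Set (PacketAlgebra p k)) = normalizedPacket p k :=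
  le_antisymm (autImages_subset p k fun φ hφ => h4 hI hp he φ hφ) (subset_autImages p k _)

omit [DecidableEq I] in
/-- **Step (vi), the hull**: under `Prop12iv`, the holomorphic hull of the union of possible images of
`(R_I)^∼` is `(R_I)^∼` (whose log-volume is `0`: "Such an upper bound “`0`” is given in the final equality of
Proposition 1.4, (iv)"). [cite: Mochizuki2012, IUTchIV Thm 1.10 proof Step (vi) p.29] -/
theorem packetHull_autImages_normalizedPacket (h4 : Prop12iv p k) (hI : 2 ≤ Fintype.card I) (hp : 2 < p)
    (he : ∀ i, absRamificationIdx p (k i) = 1) :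
    packetHull p k (autImages p k (normalizedPacket p k : Set (PacketAlgebra p k))) = normalizedPacket p k := by
  rw [autImages_normalizedPacket_eq p k h4 hI hp he, packetHull_normalizedPacket]

omit [DecidableEq I] in
/-- Step (vi) for any region of possible images of points of `(R_I)^∼`: its hull lies in `(R_I)^∼`.
[cite: Mochizuki2012, IUTchIV Thm 1.10 proof Step (vi) p.29] -/
theorem packetHull_subset_normalizedPacket_of_subset_autImages (h4 : Prop12iv p k)
    (hI : 2 ≤ Fintype.card I) (hp : 2 < p) (he : ∀ i, absRamificationIdx p (k i) = 1)
    {U : Set (PacketAlgebra p k)} (hU : U ⊆ autImages p k (normalizedPacket p k : Set (PacketAlgebra p k))) :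
    packetHull p k U ⊆ normalizedPacket p k := by
  rw [← packetHull_autImages_normalizedPacket p k h4 hI hp he]
  exact packetHull_mono p k hU

end StepVI

/-! ## Admissibility of hulls: topology- and measure-agnostic helpers

For a packet model whose admissible sets are those of positive finite (Haar) measure (Dupuy–Hilado §3.5–3.6,
`M(X_{v⃗})`; the design of `AdelicPacketModel.completionModel`), the hull of a region `U` trapped between a set
of positive measure and a translate `c·(R_I)^∼` of finite measure is admissible; and for the compact-open
design, the hull is open as soon as it contains a nonempty open set. Stated for ANY measure / ANY group
topology on `V` (the cell's module topology and Haar measure on `V` are abc-iut-S7's `TensorPacketHaar`). -/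

section Adm

omit [Fintype I] [DecidableEq I] in
/-- The hull of `S` has measure at least that of `S` and at most that of any translate `c·(R_I)^∼` containing
`S` (monotonicity of outer measure; no measurability needed). [cite: DupuyHilado2025, §4.12 p. 16] -/
theorem measure_le_packetHull_le [MeasurableSpace (PacketAlgebra p k)]
    (μ : MeasureTheory.Measure (PacketAlgebra p k)) {S : Set (PacketAlgebra p k)} {c : PacketAlgebra p k}
    (h : S ⊆ c • (normalizedPacket p k : Set (PacketAlgebra p k))) :
    μ S ≤ μ (packetHull p k S) ∧
      μ (packetHull p k S) ≤ μ (c • (normalizedPacket p k : Set (PacketAlgebra p k))) :=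
  ⟨MeasureTheory.measure_mono (subset_packetHull p k S),
    MeasureTheory.measure_mono (packetHull_subset_smul_normalizedPacket p k h)⟩

omit [Fintype I] [DecidableEq I] in
/-- Hence: if `S` has positive measure and lies in a translate `c·(R_I)^∼` of finite measure, its hull has
positive finite measure ("`−|log(Θ)| ∈ ℝ`"-type admissibility of hulls). [cite: DupuyHilado2025, §4.12 p. 16] -/
theorem measure_packetHull_pos_lt_top [MeasurableSpace (PacketAlgebra p k)]
    (μ : MeasureTheory.Measure (PacketAlgebra p k)) {S : Set (PacketAlgebra p k)} {c : PacketAlgebra p k}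
    (h : S ⊆ c • (normalizedPacket p k : Set (PacketAlgebra p k))) (hS : 0 < μ S)
    (hc : μ (c • (normalizedPacket p k : Set (PacketAlgebra p k))) < ⊤) :
    0 < μ (packetHull p k S) ∧ μ (packetHull p k S) < ⊤ :=
  ⟨hS.trans_le (measure_le_packetHull_le p k μ h).1, (measure_le_packetHull_le p k μ h).2.trans_lt hc⟩

omit [Fintype I] [DecidableEq I] in
/-- For any group topology on `V`: the hull of `S` (an additive subgroup) is OPEN as soon as it contains a
nonempty open set. [cite: DupuyHilado2025, §4.12 p. 16] -/
theorem isOpen_packetHull_of_isOpen_subset [TopologicalSpace (PacketAlgebra p k)]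
    [IsTopologicalAddGroup (PacketAlgebra p k)] {S O : Set (PacketAlgebra p k)} (hO : IsOpen O)
    (hne : O.Nonempty) (h : O ⊆ packetHull p k S) : IsOpen (packetHull p k S) := by
  obtain ⟨x, hx⟩ := hne
  rw [packetHull_apply] at h ⊢
  exact (packetSpan p k S).toAddSubgroup.isOpen_of_mem_nhds (g := x)
    (Filter.mem_of_superset (hO.mem_nhds hx) h)

end Adm

end Literature.IUT.LogVolume

end
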